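import Mathlib
import Literature.NumberTheory.LFunctions.Zhang2022.TypedAppendixB
import HarnessLib

/-!
# Zhang (2022) App. B, proof of Lemma 15.1: the Perron identity
# `Σ_l ϰ_μ(l₁l)ϱ_j(l)/l = (1/2πi)∫_{(1)} ζ(1+s)/ζ(1+s−β_j)·(P_μ/l₁)ˢ/((log P_μ)(s−β)²) ds`
# GENERIC in the Perron data `(P_μ, β)`, with the `μ = 1` (`P₁, β₆`) and `μ = 3` (`P₃, β₆`) instances

Topic `Literature/NumberTheory/LFunctions/Zhang2022` (Landau–Siegel audit tree; verdict-neutral).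
Y. Zhang, *Discrete mean estimates and the Landau–Siegel zero*, arXiv:2211.02515v1 (2022)
[Zhang2022LandauSiegel] — **an unrefereed manuscript under adjudication; nothing in this file asserts
any claim of the manuscript beyond the identities it PROVES.** ZHANG-L discharge lane (WP15, App. B
part B4 under leaf `Typed.Section15C.Eq15_22` / Lemma 15.1 χR(E); seat zl-w09-p5). DAG nodes
`Z22:§B.u008`/`Z22:§B.u009` [Z22 p.107, tex L5292–5296] ("`ϰ₂(m) = (1/2πi)∫_{(1)} (P₂/m)ˢ ds/((log P₂)(s−β₇)²)`
… it follows that `Σ_l ϰ₂(l₁l)ϱ_j(l)/l = (1/2πi)∫_{(1)} …`"), which the manuscript re-uses for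
`μ = 3` ("with `β₆` and `P₃` in place of `β₇` and `P₂`") and `μ = 1` ("The same argument also gives …",
tex L5310–5311). The `μ = 2` case is the tree's `stepB_u008_holds`/`kerB_line`/`stepB_u009_holds`
(`TypedAppendixB`, §Discharges); this file is their TWIN written once for an ARBITRARY Perron base
`P_μ > 1` with `P_μ ≤ P` and an ARBITRARY purely imaginary pole `β`:

* `vline_kerB_eq` — Perron's formula `(1/2πi)∫_{(1)} (P_μ/m)ˢ ds/((log P_μ)(s−β)²) =
  (1 − log m/log P_μ)(P_μ/m)^β·[m < P_μ]` (the weight (8.6) with data `(P_μ, β)`), via the tree's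
  `Literature.Analysis.Complex.integral_perronPow_vertical`;
* `kerB_line_gen` — absolute integrability of the kernel on `Re s = 1`, `∫‖·‖ = π(P_μ/m)/log P_μ`,
  `∫ = 2π·(weight)`;
* `vkSum_eq_vline_gen` — the Perron identity for the weight `n ↦ (1 − log n/log P_μ)(P_μ/n)^β·[n < P_μ]`
  (`StepB_u007` at `1+s`, termwise Perron, `Σ_l`/`∫` interchanged by absolute convergence);
* instances: `vkSum_vk1_eq_vline` (`μ = 1`: `Skeleton.vk1`, `(P₁, β₆)`) — the hypothesis `h9` of
  `Skeleton.stepB_u012R_of` (`AppendixBLemma151Mu1Circles`) — and `vkSum_vk3_eq_vline` (`μ = 3`: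
  `Skeleton.vk3`, `(P₃, β₆)`) — the hypothesis `h9` of `Skeleton.stepB_mu3R_of` (`AppendixBLemma151Mu3Circles`).

WHAT THIS IS NOT: the contour shift (line → circle), any residue evaluation, Lemma 15.1, or any claim
about Theorems 1–2 / Landau–Siegel zeros.

## References

* Y. Zhang, arXiv:2211.02515v1 (2022), App. B p. 107; §8 (8.6); §2 (2.21)–(2.22).
  [cite: Zhang2022LandauSiegel, App. B p.107]
-/

noncomputable section

open Complex Real MeasureTheory

namespace Literature.NumberTheory.LFunctions.Zhang2022.Typed.AppendixB

section PerronGeneric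

/-- **Perron's formula for the App. B kernel, generic data `(P_μ, β)`** (`P_μ > 1`, `m ≥ 1`, `Re β = 0`):
`(1/2πi)∫_{(1)} (P_μ/m)ˢ ds/((log P_μ)(s−β)²) = (1 − log m/log P_μ)(P_μ/m)^β` if `m < P_μ`, and `= 0`
otherwise (the weight (8.6) with data `(P_μ, β)`; twin of `stepB_u008_holds`).
[cite: Zhang2022LandauSiegel, App. B p.107] -/
theorem vline_kerB_eq {Pμ : ℝ} (hP : 1 < Pμ) {β : ℂ} (hβ : β.re = 0) {m : ℕ} (hm : 1 ≤ m) :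
    vline 1 (kerB Pμ β m) =
      if (m : ℝ) < Pμ then ((1 - Real.log m / Real.log Pμ : ℝ) : ℂ) * ((Pμ / m : ℝ) : ℂ) ^ β
      else 0 := by
  have hPpos : 0 < Pμ := by linarith
  have hlogP : 0 < Real.log Pμ := Real.log_pos hP
  have hm0 : (0 : ℝ) < m := by exact_mod_cast hm
  set y : ℝ := Pμ / m with hy
  have hy0 : 0 < y := div_pos hPpos hm0
  have hy' : (y : ℂ) ≠ 0 := by exact_mod_cast hy0.ne'
  set b : ℝ := β.im with hb
  have hβI : β = (b : ℂ) * I := by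
    apply Complex.ext <;> simp [hb, hβ]
  -- the integrand on the line `Re s = 1`, recentred at `β`
  set g : ℝ → ℂ := fun u => Literature.Analysis.Complex.perronPow y 1 (((1 : ℝ) : ℂ) + (u : ℂ) * I)
    with hg
  have hF : ∀ t : ℝ, kerB Pμ β m (((1 : ℝ) : ℂ) + (t : ℂ) * I) =
      ((y : ℂ) ^ β / (Real.log Pμ : ℂ)) * g (t - b) := by
    intro t
    simp only [hg, kerB, Literature.Analysis.Complex.perronPow]
    have hsplit : ((1 : ℝ) : ℂ) + (t : ℂ) * I = β + (((1 : ℝ) : ℂ) + ((t - b : ℝ) : ℂ) * I) := by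
      rw [hβI]; push_cast; ring
    rw [hsplit, Complex.cpow_add _ _ hy', add_sub_cancel_left]
    generalize (((1 : ℝ) : ℂ) + ((t - b : ℝ) : ℂ) * I) = w
    ring
  have hvline : vline 1 (kerB Pμ β m) =
      (1 / (2 * Real.pi) : ℂ) * (((y : ℂ) ^ β / (Real.log Pμ : ℂ)) * ∫ t : ℝ, g t) := by
    rw [vline]
    congr 1
    simp_rw [hF]
    rw [MeasureTheory.integral_const_mul, MeasureTheory.integral_sub_right_eq_self g b]
  have hperron : ∫ t : ℝ, g t =
      if 1 ≤ y then 2 * Real.pi * (((Real.log y : ℝ) : ℂ) ^ 1 / ((1 : ℕ).factorial : ℂ)) else 0 :=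
    Literature.Analysis.Complex.integral_perronPow_vertical hy0 one_pos le_rfl
  rw [hvline, hperron]
  have hπ : (Real.pi : ℂ) ≠ 0 := by exact_mod_cast Real.pi_ne_zero
  have hlog' : (Real.log Pμ : ℂ) ≠ 0 := by exact_mod_cast hlogP.ne'
  by_cases hlt : (m : ℝ) < Pμ
  · -- `y > 1`
    have hy1 : 1 < y := by rw [hy, lt_div_iff₀ hm0]; linarith
    rw [if_pos hlt, if_pos hy1.le]
    have hlogy : Real.log y = Real.log Pμ - Real.log m := by
      rw [hy, Real.log_div hPpos.ne' hm0.ne']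
    rw [hlogy]
    push_cast
    field_simp
    ring
  · rw [if_neg hlt]
    push Not at hlt
    rcases hlt.eq_or_lt with heq | hgt
    · -- `y = 1`: `log y = 0`
      have hy1 : y = 1 := by rw [hy, ← heq, div_self hPpos.ne']
      rw [if_pos hy1.ge, hy1, Real.log_one]
      simp
    · -- `y < 1`
      have hy1 : ¬ 1 ≤ y := by
        rw [not_le, hy, div_lt_one hm0]; exact hgt
      rw [if_neg hy1]
      simp

/-- The kernel with generic data `(P_μ, β)` on the line `Re s = 1` (`P_μ > 1`, `Re β = 0`, `m ≥ 1`):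
absolutely integrable with `∫‖(P_μ/m)ˢ/((log P_μ)(s−β)²)‖ dt = π(P_μ/m)/log P_μ`, and
`∫ = 2π·(1/2πi)∫_{(1)}` (twin of `kerB_line`). [cite: Zhang2022LandauSiegel, App. B p.107] -/
theorem kerB_line_gen {Pμ : ℝ} (hP : 1 < Pμ) {β : ℂ} (hβ : β.re = 0) {m : ℕ} (hm : 1 ≤ m) :
    Integrable (fun t : ℝ => kerB Pμ β m (((1 : ℝ) : ℂ) + (t : ℂ) * I)) ∧
    (∫ t : ℝ, ‖kerB Pμ β m (((1 : ℝ) : ℂ) + (t : ℂ) * I)‖) = Pμ / m / Real.log Pμ * π ∧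
    (∫ t : ℝ, kerB Pμ β m (((1 : ℝ) : ℂ) + (t : ℂ) * I)) = 2 * π * vline 1 (kerB Pμ β m) := by
  have hPpos : 0 < Pμ := by linarith
  have hlogP : 0 < Real.log Pμ := Real.log_pos hP
  have hm0 : (0 : ℝ) < m := by exact_mod_cast hm
  set y : ℝ := Pμ / m with hy
  have hy0 : 0 < y := div_pos hPpos hm0
  have hy' : (y : ℂ) ≠ 0 := by exact_mod_cast hy0.ne'
  set b : ℝ := β.im with hb
  have hβI : β = (b : ℂ) * I := by
    apply Complex.ext <;> simp [hb, hβ]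
  set g : ℝ → ℂ := fun u => Literature.Analysis.Complex.perronPow y 1 (((1 : ℝ) : ℂ) + (u : ℂ) * I)
    with hg
  have hF : ∀ t : ℝ, kerB Pμ β m (((1 : ℝ) : ℂ) + (t : ℂ) * I) =
      ((y : ℂ) ^ β / (Real.log Pμ : ℂ)) * g (t - b) := by
    intro t
    simp only [hg, kerB, Literature.Analysis.Complex.perronPow]
    have hsplit : ((1 : ℝ) : ℂ) + (t : ℂ) * I = β + (((1 : ℝ) : ℂ) + ((t - b : ℝ) : ℂ) * I) := by
      rw [hβI]; push_cast; ring
    rw [hsplit, Complex.cpow_add _ _ hy', add_sub_cancel_left]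
    generalize (((1 : ℝ) : ℂ) + ((t - b : ℝ) : ℂ) * I) = w
    ring
  have hfun : (fun t : ℝ => kerB Pμ β m (((1 : ℝ) : ℂ) + (t : ℂ) * I)) =
      fun t => ((y : ℂ) ^ β / (Real.log Pμ : ℂ)) * g (t - b) := funext hF
  have hgi : Integrable g :=
    Literature.Analysis.Complex.integrable_perronPow_vertical hy0 le_rfl one_ne_zero
  refine ⟨?_, ?_, ?_⟩
  · rw [hfun]; exact (hgi.comp_sub_right b).const_mul _
  · -- the norm: `‖kerB‖ = (y/log P_μ)(1 + (t−b)²)⁻¹`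
    have hnorm : ∀ t : ℝ, ‖kerB Pμ β m (((1 : ℝ) : ℂ) + (t : ℂ) * I)‖ =
        y / Real.log Pμ * (1 + (t - b) ^ 2)⁻¹ := by
      intro t
      simp only [kerB, ← hy]
      have hsub : ((1 : ℝ) : ℂ) + (t : ℂ) * I - β = ((1 : ℝ) : ℂ) + ((t - b : ℝ) : ℂ) * I := by
        rw [hβI]; push_cast; ring
      have hre : (((1 : ℝ) : ℂ) + (t : ℂ) * I).re = 1 := by simp
      rw [norm_div, norm_mul, norm_pow, hsub, Complex.norm_cpow_eq_rpow_re_of_pos hy0, hre,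
        Real.rpow_one, Complex.norm_real, Real.norm_of_nonneg hlogP.le, Complex.sq_norm,
        Complex.normSq_add_mul_I, one_pow, div_mul_eq_div_div, div_eq_mul_inv]
    simp_rw [hnorm]
    rw [MeasureTheory.integral_const_mul,
      MeasureTheory.integral_sub_right_eq_self (fun t : ℝ => (1 + t ^ 2)⁻¹) b,
      integral_univ_inv_one_add_sq, hy]
  · rw [vline]
    have hπ : (π : ℂ) ≠ 0 := by exact_mod_cast Real.pi_ne_zero
    rw [← mul_assoc, show (2 * (π : ℂ)) * (1 / (2 * π)) = 1 by field_simp, one_mul]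

/-- **The Perron identity, generic data `(P_μ, β)`** (`1 < P_μ ≤ P`, `Re β = 0`): for every `D`,
`j ∈ {1,2,3}`, `l₁ ≥ 1`, with the weight `ϰ(n) = (1 − log n/log P_μ)(P_μ/n)^β·[n < P_μ]`,
`Σ_{1≤l<⌈P⌉} ϰ(l₁l)ϱ_j(l)/l = (1/2πi)∫_{(1)} ζ(1+s)/ζ(1+s−β_j)·(P_μ/l₁)ˢ/((log P_μ)(s−β)²) ds`
(`StepB_u007` at `1+s`, Perron termwise, `Σ_l`/`∫` interchanged by absolute convergence
`Σ_l |ϱ_j(l)| l⁻² < ∞`; twin of `stepB_u009_holds`). [cite: Zhang2022LandauSiegel, App. B p.107] -/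
theorem vkSum_eq_vline_gen (c' : ℝ) (D : ℕ) {Pμ : ℝ} (hP : 1 < Pμ) (hPP : Pμ ≤ Skeleton.bigP D)
    {β : ℂ} (hβ : β.re = 0) {j : ℕ} (hj : j ∈ ({1, 2, 3} : Finset ℕ)) {l₁ : ℕ} (hl₁ : 1 ≤ l₁) :
    vkSum c' D (fun n => if (n : ℝ) < Pμ then
        ((1 - Real.log n / Real.log Pμ : ℝ) : ℂ) * ((Pμ / n : ℝ) : ℂ) ^ β else 0) j l₁ =
      vline 1 (fun s => zetaRatio c' D j s * kerB Pμ β l₁ s) := by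
  have hPpos : 0 < Pμ := by linarith
  have hlogP : 0 < Real.log Pμ := Real.log_pos hP
  have hl₁0 : (0 : ℝ) < l₁ := by exact_mod_cast hl₁
  -- the summands
  set G : ℕ → ℝ → ℂ := fun l t =>
    varrhoJ c' D j l / (l : ℂ) * kerB Pμ β (l₁ * l) (((1 : ℝ) : ℂ) + (t : ℂ) * I) with hGdef
  -- Step A: the integrand is `Σ' l, G l t`
  have hA : ∀ t : ℝ, zetaRatio c' D j (((1 : ℝ) : ℂ) + (t : ℂ) * I) *
      kerB Pμ β l₁ (((1 : ℝ) : ℂ) + (t : ℂ) * I) = ∑' l : ℕ, G l t := by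
    intro t
    simp only [zetaRatio, hGdef]
    set s : ℂ := ((1 : ℝ) : ℂ) + (t : ℂ) * I with hsdef
    have hs2 : 1 < (1 + s).re := by simp [hsdef]
    have h7 := stepB_u007_holds c' D j hj (1 + s) hs2
    rw [← h7, LSeries, ← tsum_mul_right]
    refine tsum_congr fun l => ?_
    rcases eq_or_ne l 0 with rfl | hl
    · simp
    have hl0 : (0 : ℝ) < l := by exact_mod_cast Nat.pos_of_ne_zero hl
    have hlc : (l : ℂ) ≠ 0 := by exact_mod_cast hl
    rw [LSeries.term_of_ne_zero hl, kerB, kerB, Complex.cpow_add _ _ hlc, Complex.cpow_one,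
      show (Pμ / (l₁ * l : ℕ) : ℝ) = Pμ / l₁ / l by push_cast; rw [div_div],
      GaussWeight.div_cpow_line (div_pos hPpos hl₁0) hl0, Complex.ofReal_natCast]
    ring
  -- Step B/C: termwise integrability, norms and values
  have hker : ∀ l : ℕ, 1 ≤ l →
      Integrable (G l) ∧
      (∫ t : ℝ, ‖G l t‖) = ‖varrhoJ c' D j l‖ / l * (Pμ / (l₁ * l : ℕ) / Real.log Pμ * π) ∧
      (∫ t : ℝ, G l t) = varrhoJ c' D j l / (l : ℂ) * (2 * π * vline 1 (kerB Pμ β (l₁ * l))) := by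
    intro l hl
    obtain ⟨hi, hn, hv⟩ := kerB_line_gen hP hβ (m := l₁ * l)
      (Nat.one_le_iff_ne_zero.mpr (mul_ne_zero (by omega) (by omega)))
    refine ⟨hi.const_mul _, ?_, ?_⟩
    · simp only [hGdef, norm_mul, MeasureTheory.integral_const_mul, hn, norm_div, Complex.norm_natCast]
    · simp only [hGdef, MeasureTheory.integral_const_mul, hv]
  have hG0 : G 0 = fun _ => 0 := by funext t; simp [hGdef]
  have hint : ∀ l : ℕ, Integrable (G l) := by
    intro l
    rcases Nat.eq_zero_or_pos l with rfl | hl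
    · rw [hG0]; exact integrable_zero _ _ _
    · exact (hker l hl).1
  have hsum : Summable fun l : ℕ => ∫ t : ℝ, ‖G l t‖ := by
    obtain ⟨C, hC1, hC⟩ :=
      Literature.NumberTheory.Sieve.exists_card_divisors_le_mul_rpow' (ε := (1 / 2 : ℝ)) (by norm_num)
    have hmaj : Summable (fun l : ℕ =>
        (C * (Pμ / l₁ / Real.log Pμ * π)) * (l : ℝ) ^ (-(3 / 2 : ℝ))) := by
      refine (Real.summable_nat_rpow.mpr ?_).mul_left _
      norm_num
    refine hmaj.of_nonneg_of_le (fun l => integral_nonneg fun t => norm_nonneg _) fun l => ?_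
    rcases Nat.eq_zero_or_pos l with rfl | hl
    · simp [hG0, Real.zero_rpow (by norm_num : -(3 / 2 : ℝ) ≠ 0)]
    rw [(hker l hl).2.1]
    have hl0 : (0 : ℝ) < l := by exact_mod_cast hl
    have hρ : ‖varrhoJ c' D j l‖ ≤ C * (l : ℝ) ^ (1 / 2 : ℝ) := (norm_varrhoJ_le c' D j l).trans (hC l)
    have hK : 0 ≤ Pμ / l₁ / Real.log Pμ * π := by positivity
    calc ‖varrhoJ c' D j l‖ / l * (Pμ / (l₁ * l : ℕ) / Real.log Pμ * π)
        = ‖varrhoJ c' D j l‖ * ((Pμ / l₁ / Real.log Pμ * π) * ((l : ℝ) * l)⁻¹) := by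
          push_cast
          field_simp
      _ ≤ (C * (l : ℝ) ^ (1 / 2 : ℝ)) * ((Pμ / l₁ / Real.log Pμ * π) * ((l : ℝ) * l)⁻¹) := by
          gcongr
      _ = (C * (Pμ / l₁ / Real.log Pμ * π)) * ((l : ℝ) ^ (1 / 2 : ℝ) * ((l : ℝ) * l)⁻¹) := by
          ring
      _ = (C * (Pμ / l₁ / Real.log Pμ * π)) * (l : ℝ) ^ (-(3 / 2 : ℝ)) := by
          congr 1
          rw [show ((l : ℝ) * l)⁻¹ = (l : ℝ) ^ (-(2 : ℝ)) by
            rw [Real.rpow_neg hl0.le, Real.rpow_two, pow_two], ← Real.rpow_add hl0]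
          norm_num
  -- Step D: assemble
  rw [vline]
  simp_rw [hA]
  rw [← MeasureTheory.integral_tsum_of_summable_integral_norm hint hsum]
  have hval : ∀ l : ℕ, (∫ t : ℝ, G l t) =
      2 * π * (vline 1 (kerB Pμ β (l₁ * l)) * varrhoJ c' D j l / (l : ℂ)) := by
    intro l
    rcases Nat.eq_zero_or_pos l with rfl | hl
    · simp [hG0]
    · rw [(hker l hl).2.2]; ring
  simp_rw [hval]
  rw [tsum_mul_left, ← mul_assoc]
  have hπ : (π : ℂ) ≠ 0 := by exact_mod_cast Real.pi_ne_zero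
  have hone : (1 / (2 * (π : ℂ))) * (2 * π) = 1 := by field_simp
  rw [hone, one_mul, vkSum]
  -- the finite sum, termwise, IS Perron's formula (`vline_kerB_eq`)
  have hfin : ∑ l ∈ Finset.Ico 1 ⌈Skeleton.bigP D⌉₊,
      (fun n : ℕ => if (n : ℝ) < Pμ then
        ((1 - Real.log n / Real.log Pμ : ℝ) : ℂ) * ((Pμ / n : ℝ) : ℂ) ^ β else 0) (l₁ * l) *
          varrhoJ c' D j l / (l : ℂ) =
      ∑ l ∈ Finset.Ico 1 ⌈Skeleton.bigP D⌉₊, vline 1 (kerB Pμ β (l₁ * l)) * varrhoJ c' D j l / (l : ℂ) := by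
    refine Finset.sum_congr rfl fun l hl => ?_
    have hl1 : 1 ≤ l := (Finset.mem_Ico.mp hl).1
    have hm1 : 1 ≤ l₁ * l := Nat.one_le_iff_ne_zero.mpr (mul_ne_zero (by omega) (by omega))
    rw [vline_kerB_eq hP hβ hm1]
  rw [hfin]
  symm
  refine tsum_eq_sum fun l hl => ?_
  -- terms outside `1 ≤ l < P` vanish
  rcases Nat.eq_zero_or_pos l with rfl | hlpos
  · simp [varrhoJ]
  · have hlP : ⌈Skeleton.bigP D⌉₊ ≤ l := by
      by_contra h
      push Not at h
      exact hl (Finset.mem_Ico.mpr ⟨hlpos, h⟩)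
    have hm1 : 1 ≤ l₁ * l := Nat.one_le_iff_ne_zero.mpr (mul_ne_zero (by omega) (by omega))
    have hge : ¬ ((l₁ * l : ℕ) : ℝ) < Pμ := by
      push Not
      have hlreal : Skeleton.bigP D ≤ (l : ℝ) := le_trans (Nat.le_ceil _) (by exact_mod_cast hlP)
      calc Pμ ≤ Skeleton.bigP D := hPP
        _ ≤ l := hlreal
        _ ≤ ((l₁ * l : ℕ) : ℝ) := by
            push_cast; exact le_mul_of_one_le_left (by positivity) (by exact_mod_cast hl₁)
    rw [vline_kerB_eq hP hβ hm1, if_neg hge, zero_mul, zero_div]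

end PerronGeneric

/-! ## The instances `μ = 1` (`P₁, β₆`, weight `ϰ₁`) and `μ = 3` (`P₃, β₆`, weight `ϰ₃`) -/

section Instances

/-- `𝓛 ≥ 2` for `D ≥ 8`. [folklore] -/
private theorem two_le_ell_of_eight_le {D : ℕ} (hD : 8 ≤ D) : 2 ≤ Skeleton.ell D := by
  have h8 : (8 : ℝ) ≤ D := by exact_mod_cast hD
  have he : Real.exp 2 ≤ 8 := by
    have h1 := Real.exp_one_lt_d9
    have : Real.exp 2 = Real.exp 1 * Real.exp 1 := by rw [← Real.exp_add]; norm_num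
    rw [this]; nlinarith [Real.exp_pos 1]
  calc (2 : ℝ) = Real.log (Real.exp 2) := (Real.log_exp 2).symm
    _ ≤ Real.log 8 := Real.log_le_log (Real.exp_pos 2) he
    _ ≤ Skeleton.ell D := Real.log_le_log (by norm_num) h8

/-- `1 < P^θ ≤ P` for `0 < θ ≤ 1` and `D ≥ 8` (`P = e^{𝓛⁹}`, `𝓛 ≥ 2`).
[cite: Zhang2022LandauSiegel, §2 (2.21)] -/
theorem one_lt_bigP_rpow_and_le {D : ℕ} (hD : 8 ≤ D) {θ : ℝ} (hθ0 : 0 < θ) (hθ1 : θ ≤ 1) :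
    1 < Skeleton.bigP D ^ θ ∧ Skeleton.bigP D ^ θ ≤ Skeleton.bigP D := by
  have hℓ : 2 ≤ Skeleton.ell D := two_le_ell_of_eight_le hD
  have hP1 : 1 < Skeleton.bigP D := by
    rw [Skeleton.bigP]; exact Real.one_lt_exp_iff.mpr (by positivity)
  refine ⟨Real.one_lt_rpow hP1 hθ0, ?_⟩
  calc Skeleton.bigP D ^ θ ≤ Skeleton.bigP D ^ (1 : ℝ) :=
        Real.rpow_le_rpow_of_exponent_le hP1.le hθ1
    _ = Skeleton.bigP D := Real.rpow_one _

/-- **The `μ = 1` Perron identity** ("The same argument also gives …", App. B p. 107): for `D ≥ 8`,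
`j ∈ {1,2,3}`, `l₁ ≥ 1`, `Σ_l ϰ₁(l₁l)ϱ_j(l)/l = (1/2πi)∫_{(1)} ζ(1+s)/ζ(1+s−β_j)·(P₁/l₁)ˢ/((log P₁)(s−β₆)²) ds`
— the hypothesis `h9` of `Skeleton.stepB_u012R_of`. [cite: Zhang2022LandauSiegel, App. B p.107] -/
theorem vkSum_vk1_eq_vline (c' : ℝ) : Skeleton.ForAllLarge fun D _ _ =>
    ∀ j ∈ ({1, 2, 3} : Finset ℕ), ∀ l₁ : ℕ, 1 ≤ l₁ →
      vkSum c' D (Skeleton.vk1 D) j l₁ =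
        vline 1 (fun s => zetaRatio c' D j s * kerB (Skeleton.P1 D) (Skeleton.beta6 D) l₁ s) := by
  refine ⟨8, fun D _ _ hD _ _ j hj l₁ hl₁ => ?_⟩
  obtain ⟨hP, hPP⟩ := one_lt_bigP_rpow_and_le hD (θ := 0.504) (by norm_num) (by norm_num)
  have hβ : (Skeleton.beta6 D).re = 0 := by simp [Skeleton.beta6]
  have hvk : Skeleton.vk1 D = fun n : ℕ => if (n : ℝ) < Skeleton.P1 D then
      ((1 - Real.log n / Real.log (Skeleton.P1 D) : ℝ) : ℂ) *
        ((Skeleton.P1 D / n : ℝ) : ℂ) ^ Skeleton.beta6 D else 0 := by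
    funext n; rfl
  rw [hvk]
  exact vkSum_eq_vline_gen c' D hP hPP hβ hj hl₁

/-- **The `μ = 3` Perron identity** ("In case `μ = 3` the proof can be obtained with `β₆` and `P₃` in
place of `β₇` and `P₂`", App. B p. 107): for `D ≥ 8`, `j ∈ {1,2,3}`, `l₁ ≥ 1`,
`Σ_l ϰ₃(l₁l)ϱ_j(l)/l = (1/2πi)∫_{(1)} ζ(1+s)/ζ(1+s−β_j)·(P₃/l₁)ˢ/((log P₃)(s−β₆)²) ds` — the hypothesis
`h9` of `Skeleton.stepB_mu3R_of`. [cite: Zhang2022LandauSiegel, App. B p.107] -/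
theorem vkSum_vk3_eq_vline (c' : ℝ) : Skeleton.ForAllLarge fun D _ _ =>
    ∀ j ∈ ({1, 2, 3} : Finset ℕ), ∀ l₁ : ℕ, 1 ≤ l₁ →
      vkSum c' D (Skeleton.vk3 D) j l₁ =
        vline 1 (fun s => zetaRatio c' D j s * kerB (Skeleton.P3 D) (Skeleton.beta6 D) l₁ s) := by
  refine ⟨8, fun D _ _ hD _ _ j hj l₁ hl₁ => ?_⟩
  obtain ⟨hP, hPP⟩ := one_lt_bigP_rpow_and_le hD (θ := 0.498) (by norm_num) (by norm_num)
  have hβ : (Skeleton.beta6 D).re = 0 := by simp [Skeleton.beta6]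
  have hvk : Skeleton.vk3 D = fun n : ℕ => if (n : ℝ) < Skeleton.P3 D then
      ((1 - Real.log n / Real.log (Skeleton.P3 D) : ℝ) : ℂ) *
        ((Skeleton.P3 D / n : ℝ) : ℂ) ^ Skeleton.beta6 D else 0 := by
    funext n; rfl
  rw [hvk]
  exact vkSum_eq_vline_gen c' D hP hPP hβ hj hl₁

end Instances

end Literature.NumberTheory.LFunctions.Zhang2022.Typed.AppendixB
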